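import Summits.BirchSwinnertonDyer.Rank1Residual.X10.MuTransferThreeOfFineShaCells
import HarnessLib

/-!
# Class X10b (N2), the F1 ROAD at `p = 3`: per-cell kernel RECORDS for Ш-CELLS, part 01 — Miller's `BSD(E,3)`
# AT THE PAIR modulo Kato's zeta-element package F1 + PUBLISHED named facts + displayed census / certificate binders,
# for 7 N2 cells with `#Ш_an = 9` that carry an exact `3`-descent `#Sel^(3)(E/ℚ) = 9` of record (40898d1, 53966a1, 55696l1, 55696n1, 110224f1, 129605x1, 183184b1)
# (cell `b2b-bsdres`, unit `b2b-bsdres-x10` = N2 class lead, GEN 41; records — theorems only, no definition,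
# no named fact, nothing booked)

HONEST FRAMING (run/shared/lean/b2b/bsd-rank1-residual/, verbatim in every file): the goal of the
cell is to DELETE the COMBINATION-SHAPED residual classes of the Birch–Swinnerton-Dyer formula for
ALL analytic-rank `≤ 1` elliptic curves over `ℚ` — "full BSD formula for every rank `≤ 1` curve in
class `C`" assembled STRICTLY from published theorems — so that the rank-`≤ 1` remainder becomes
exactly the CONSTRUCTION-SHAPED classes, which are TYPED (missing-input `Prop`s), NOT attempted.
This is not "finishing BSD". Class X10b keeps its label CONSTRUCTION-SHAPED (NEEDS X_A3, RESIDUAL-MAP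
§I N2); nothing is booked by this file (the lane books, the referee rules); everything is PER PAIR — a
SECOND ROAD for cells whose road of record is the CTP road `X10/CasselsTatePairingRecords*` (GEN 19–21).

## What (x10 GEN 41, X10-AUDIT §47; TOOL `X10/MuTransferThreeOfFineShaCells.lean`)

For each Ш-cell `E` below (analytic rank `0`, `#Ш(E/ℚ)_an = 9`; Cremona minimal model; `3 ∤ Δ`, ordinary point
count at `3` and an `E[3]`-irreducibility witness DECIDED in the kernel, EITHER image): Miller's `BSD(E,3)` from
F1 (`hfine`: the UPPER half `ord₃ #Ш ≤ ord₃ #Ш_an` via Kato 17.4-from-F1 + the `μ`-transfer) and ONE exact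
`3`-descent `hcard : #Sel^(3)(E/ℚ) = 9` (the LOWER half: at rank `0` with `E[3]` irreducible,
`#(Ш ⊓ H¹(ℚ,E)[3]) = #Sel^(3)`, Silverman X.4.2 (a), so `9 ∣ #Ш`) — NO Cassels–Tate pairing certificate, NO
Cassels–Tate squareness, NO Wuthrich.  DISPLAYED: F1; PUBLISHED `hS` (A35), `hmodP` (A19), `hGZK` (A18), `h3`
(A25); census / certificates `hL` (`L(E,1) ≠ 0`), `hcertA` (MUCERT3, three engines), `hcard` (the two-engine
exact `3`-descent of record, T2-BATCH-G10 / `X10/CasselsTatePairingRecords*`), `hq`/`hv` (`#Ш_an = 9`, Cremona).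

References: [Kato2004Asterisque] Thm. 12.6, Thm. 17.4, §17.13; [SilvermanAEC2009] Thm. X.4.2 (a);
[GreenbergLNM1716] Thm. 4.1; [Mazur1978] Prop. 6.3 (1); [Miller2011LMS] Def. 1.1; [Cremona2006] tables.
-/

set_option autoImplicit false

noncomputable section

open scoped Classical MatrixGroups ModularForm

open CongruenceSubgroup WeierstrassCurve Field Literature.NumberTheory.EllipticCurves
  Literature.NumberTheory.EllipticCurves.ModularForms Literature.NumberTheory.EllipticCurves.Rank1Residual
  Literature.NumberTheory.EllipticCurves.Kato2004
  Literature.NumberTheory.EllipticCurves.Rank1Residual.X11RankOneCertificates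
  Summit.BirchSwinnertonDyer.BirchSwinnertonDyer.Rank1Residual.IntModel
  Summit.BirchSwinnertonDyer.BirchSwinnertonDyer.Theorems.Rank1ResidualX1Defs
  Summit.BirchSwinnertonDyer.BirchSwinnertonDyer.Rank1Residual

namespace Summit.BirchSwinnertonDyer.Rank1Residual.X10.MuZeroRoad

/-! ### `40898d1` (3Ns, `N = 40898 = 2·11^2·13^2`, analytic rank `0`, `#Ш_an = 9` — Ш-CELL, core A5 cell) -/

/-- **`BSD(E,3)` AT THE PAIR `(40898d1, 3)` MODULO F1 + PUBLISHED FACTS + CERTIFICATES — Ш-cell on the F1 road**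
(`MuZeroRoad.bsdp_three_shaCell_of_ainvs_of_fine_of_card_selmerThree`: F1 upper half + ONE exact `3`-descent lower
half; NO CTP pairing certificate). Cremona model `[1, 0, 1, -7249597, -7544452368]`, `N = 40898 = 2·11^2·13^2`, census image `3Ns`; IN THE KERNEL:
`3 ∤ Δ`, `#Ẽ(𝔽₃) = 6` (`a₃ = -2`: good ORDINARY, ANOMALOUS), Frobenius witness `ℓ = 31`: `ℓ ∤ Δ`, `#Ẽ(𝔽_{31}) = 32`
(`a_{31} = 0`), `X² − a_{31}X + 31` root-free mod `3` (`E[3]` irreducible). Cremona `allbsd`: analytic rank `0`,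
`#E(ℚ)_tors = 1`, `∏ c_ℓ = 4`, `#Ш_an = 9`. DISPLAYED: F1 (`hfine`); PUBLISHED `hS`, `hmodP`, `hGZK`, `h3`; census /
certificates `hL`, `hcertA` (MUCERT3), `hcard` (`#Sel^(3)(E/ℚ) = 9`, the two-engine exact `3`-descent of record — the
same binder as the CTP record `bsdp_t40898d1`), `hq`/`hv` (`ord₃ #Ш_an = 2`). Second road; per pair; nothing booked.
[cite: Kato2004Asterisque, Thm. 12.6 (p. 222), Thm. 17.4 (2), (3) (p. 273) and §17.13 (pp. 279–280)]
[cite: SilvermanAEC2009, Thm. X.4.2 (a)] [cite: Mazur1978, §6 Prop. 6.3 (1) (p. 153)]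
[cite: Miller2011LMS, Def. 1.1 (arXiv:1010.2431 p. 3)] [cite: Cremona2006, Table 1 (Cremona label 40898d1)] -/
theorem bsdp_three_sha_e40898d1_of_fine
    (hfine : exists_divisibilityInputs_fineQuotient_zeta)
    (hS : Schneider1985_order_charGenerator_odd) (hmodP : nonempty_modularParametrizationData)
    (hGZK : rank_eq_analyticRank_of_analyticRank_le_one) (h3 : realPeriodRat_eq_unit_mul_plusPeriod_three)
    (W : WeierstrassCurve ℚ) [W.IsElliptic] [W.IsGloballyMinimal]
    (hI : integralModelInt W = ⟨1, 0, 1, (-7249597), (-7544452368)⟩) (hL : W.entireLFunction 1 ≠ 0)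
    (hcertA : ∀ {N : ℕ} [NeZero N] (f : CuspForm (Gamma0 N) 2), IsNewformOf W f →
      ∃ n : ℕ, ‖PowerSeries.coeff n (padicLFunction f (unitRoot W 3 : ℚ_[3]))‖ = 1)
    (hcard : Nat.card (W.selmerGroup (3 : ℤ)) = 9)
    {q : ℚ} (hq : shaAn W = (q : ℂ)) (hv : padicValRat 3 q = 2) : BSDp W 3 :=
  haveI : Fact (Nat.Prime 31) := ⟨by norm_num⟩
  bsdp_three_shaCell_of_ainvs_of_fine_of_card_selmerThree hfine hS hmodP hGZK h3 1 0 1 (-7249597) (-7544452368) hI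
    31 32 6 (by decide +kernel) (by decide +kernel) (by decide) (by decide) (by decide) (by decide +kernel)
    (by decide +kernel) (by decide +kernel) hL hcertA hcard hq hv.le

/-! ### `53966a1` (3Ns, `N = 53966 = 2·11^2·223`, analytic rank `0`, `#Ш_an = 9` — Ш-CELL, core A5 cell) -/

/-- **`BSD(E,3)` AT THE PAIR `(53966a1, 3)` MODULO F1 + PUBLISHED FACTS + CERTIFICATES — Ш-cell on the F1 road**
(`MuZeroRoad.bsdp_three_shaCell_of_ainvs_of_fine_of_card_selmerThree`: F1 upper half + ONE exact `3`-descent lower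
half; NO CTP pairing certificate). Cremona model `[1, 1, 0, -343191, -77988907]`, `N = 53966 = 2·11^2·223`, census image `3Ns`; IN THE KERNEL:
`3 ∤ Δ`, `#Ẽ(𝔽₃) = 2` (`a₃ = 2`: good ORDINARY), Frobenius witness `ℓ = 7`: `ℓ ∤ Δ`, `#Ẽ(𝔽_{7}) = 5`
(`a_{7} = 3`), `X² − a_{7}X + 7` root-free mod `3` (`E[3]` irreducible). Cremona `allbsd`: analytic rank `0`,
`#E(ℚ)_tors = 1`, `∏ c_ℓ = 6`, `#Ш_an = 9`. DISPLAYED: F1 (`hfine`); PUBLISHED `hS`, `hmodP`, `hGZK`, `h3`; census /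
certificates `hL`, `hcertA` (MUCERT3), `hcard` (`#Sel^(3)(E/ℚ) = 9`, the two-engine exact `3`-descent of record — the
same binder as the CTP record `bsdp_t53966a1`), `hq`/`hv` (`ord₃ #Ш_an = 2`). Second road; per pair; nothing booked.
[cite: Kato2004Asterisque, Thm. 12.6 (p. 222), Thm. 17.4 (2), (3) (p. 273) and §17.13 (pp. 279–280)]
[cite: SilvermanAEC2009, Thm. X.4.2 (a)] [cite: Mazur1978, §6 Prop. 6.3 (1) (p. 153)]
[cite: Miller2011LMS, Def. 1.1 (arXiv:1010.2431 p. 3)] [cite: Cremona2006, Table 1 (Cremona label 53966a1)] -/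
theorem bsdp_three_sha_e53966a1_of_fine
    (hfine : exists_divisibilityInputs_fineQuotient_zeta)
    (hS : Schneider1985_order_charGenerator_odd) (hmodP : nonempty_modularParametrizationData)
    (hGZK : rank_eq_analyticRank_of_analyticRank_le_one) (h3 : realPeriodRat_eq_unit_mul_plusPeriod_three)
    (W : WeierstrassCurve ℚ) [W.IsElliptic] [W.IsGloballyMinimal]
    (hI : integralModelInt W = ⟨1, 1, 0, (-343191), (-77988907)⟩) (hL : W.entireLFunction 1 ≠ 0)
    (hcertA : ∀ {N : ℕ} [NeZero N] (f : CuspForm (Gamma0 N) 2), IsNewformOf W f →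
      ∃ n : ℕ, ‖PowerSeries.coeff n (padicLFunction f (unitRoot W 3 : ℚ_[3]))‖ = 1)
    (hcard : Nat.card (W.selmerGroup (3 : ℤ)) = 9)
    {q : ℚ} (hq : shaAn W = (q : ℂ)) (hv : padicValRat 3 q = 2) : BSDp W 3 :=
  haveI : Fact (Nat.Prime 7) := ⟨by norm_num⟩
  bsdp_three_shaCell_of_ainvs_of_fine_of_card_selmerThree hfine hS hmodP hGZK h3 1 1 0 (-343191) (-77988907) hI
    7 5 2 (by decide +kernel) (by decide +kernel) (by decide) (by decide) (by decide) (by decide +kernel)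
    (by decide +kernel) (by decide +kernel) hL hcertA hcard hq hv.le

/-! ### `55696l1` (3Ns, `N = 55696 = 2^4·59^2`, analytic rank `0`, `#Ш_an = 9` — Ш-CELL, core A5 cell) -/

/-- **`BSD(E,3)` AT THE PAIR `(55696l1, 3)` MODULO F1 + PUBLISHED FACTS + CERTIFICATES — Ш-cell on the F1 road**
(`MuZeroRoad.bsdp_three_shaCell_of_ainvs_of_fine_of_card_selmerThree`: F1 upper half + ONE exact `3`-descent lower
half; NO CTP pairing certificate). Cremona model `[0, 1, 0, 9105136, -14983896556]`, `N = 55696 = 2^4·59^2`, census image `3Ns`; IN THE KERNEL: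
`3 ∤ Δ`, `#Ẽ(𝔽₃) = 3` (`a₃ = 1`: good ORDINARY, ANOMALOUS), Frobenius witness `ℓ = 13`: `ℓ ∤ Δ`, `#Ẽ(𝔽_{13}) = 8`
(`a_{13} = 6`), `X² − a_{13}X + 13` root-free mod `3` (`E[3]` irreducible). Cremona `allbsd`: analytic rank `0`,
`#E(ℚ)_tors = 1`, `∏ c_ℓ = 8`, `#Ш_an = 9`. DISPLAYED: F1 (`hfine`); PUBLISHED `hS`, `hmodP`, `hGZK`, `h3`; census /
certificates `hL`, `hcertA` (MUCERT3), `hcard` (`#Sel^(3)(E/ℚ) = 9`, the two-engine exact `3`-descent of record — the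
same binder as the CTP record `bsdp_t55696l1`), `hq`/`hv` (`ord₃ #Ш_an = 2`). Second road; per pair; nothing booked.
[cite: Kato2004Asterisque, Thm. 12.6 (p. 222), Thm. 17.4 (2), (3) (p. 273) and §17.13 (pp. 279–280)]
[cite: SilvermanAEC2009, Thm. X.4.2 (a)] [cite: Mazur1978, §6 Prop. 6.3 (1) (p. 153)]
[cite: Miller2011LMS, Def. 1.1 (arXiv:1010.2431 p. 3)] [cite: Cremona2006, Table 1 (Cremona label 55696l1)] -/
theorem bsdp_three_sha_e55696l1_of_fine
    (hfine : exists_divisibilityInputs_fineQuotient_zeta)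
    (hS : Schneider1985_order_charGenerator_odd) (hmodP : nonempty_modularParametrizationData)
    (hGZK : rank_eq_analyticRank_of_analyticRank_le_one) (h3 : realPeriodRat_eq_unit_mul_plusPeriod_three)
    (W : WeierstrassCurve ℚ) [W.IsElliptic] [W.IsGloballyMinimal]
    (hI : integralModelInt W = ⟨0, 1, 0, 9105136, (-14983896556)⟩) (hL : W.entireLFunction 1 ≠ 0)
    (hcertA : ∀ {N : ℕ} [NeZero N] (f : CuspForm (Gamma0 N) 2), IsNewformOf W f →
      ∃ n : ℕ, ‖PowerSeries.coeff n (padicLFunction f (unitRoot W 3 : ℚ_[3]))‖ = 1)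
    (hcard : Nat.card (W.selmerGroup (3 : ℤ)) = 9)
    {q : ℚ} (hq : shaAn W = (q : ℂ)) (hv : padicValRat 3 q = 2) : BSDp W 3 :=
  haveI : Fact (Nat.Prime 13) := ⟨by norm_num⟩
  bsdp_three_shaCell_of_ainvs_of_fine_of_card_selmerThree hfine hS hmodP hGZK h3 0 1 0 9105136 (-14983896556) hI
    13 8 3 (by decide +kernel) (by decide +kernel) (by decide) (by decide) (by decide) (by decide +kernel)
    (by decide +kernel) (by decide +kernel) hL hcertA hcard hq hv.le

/-! ### `55696n1` (3Ns, `N = 55696 = 2^4·59^2`, analytic rank `0`, `#Ш_an = 9` — Ш-CELL, core A5 cell) -/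

/-- **`BSD(E,3)` AT THE PAIR `(55696n1, 3)` MODULO F1 + PUBLISHED FACTS + CERTIFICATES — Ш-cell on the F1 road**
(`MuZeroRoad.bsdp_three_shaCell_of_ainvs_of_fine_of_card_selmerThree`: F1 upper half + ONE exact `3`-descent lower
half; NO CTP pairing certificate). Cremona model `[0, 1, 0, -2396088, -1642476716]`, `N = 55696 = 2^4·59^2`, census image `3Ns`; IN THE KERNEL:
`3 ∤ Δ`, `#Ẽ(𝔽₃) = 6` (`a₃ = -2`: good ORDINARY, ANOMALOUS), Frobenius witness `ℓ = 13`: `ℓ ∤ Δ`, `#Ẽ(𝔽_{13}) = 11`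
(`a_{13} = 3`), `X² − a_{13}X + 13` root-free mod `3` (`E[3]` irreducible). Cremona `allbsd`: analytic rank `0`,
`#E(ℚ)_tors = 1`, `∏ c_ℓ = 4`, `#Ш_an = 9`. DISPLAYED: F1 (`hfine`); PUBLISHED `hS`, `hmodP`, `hGZK`, `h3`; census /
certificates `hL`, `hcertA` (MUCERT3), `hcard` (`#Sel^(3)(E/ℚ) = 9`, the two-engine exact `3`-descent of record — the
same binder as the CTP record `bsdp_t55696n1`), `hq`/`hv` (`ord₃ #Ш_an = 2`). Second road; per pair; nothing booked.
[cite: Kato2004Asterisque, Thm. 12.6 (p. 222), Thm. 17.4 (2), (3) (p. 273) and §17.13 (pp. 279–280)]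
[cite: SilvermanAEC2009, Thm. X.4.2 (a)] [cite: Mazur1978, §6 Prop. 6.3 (1) (p. 153)]
[cite: Miller2011LMS, Def. 1.1 (arXiv:1010.2431 p. 3)] [cite: Cremona2006, Table 1 (Cremona label 55696n1)] -/
theorem bsdp_three_sha_e55696n1_of_fine
    (hfine : exists_divisibilityInputs_fineQuotient_zeta)
    (hS : Schneider1985_order_charGenerator_odd) (hmodP : nonempty_modularParametrizationData)
    (hGZK : rank_eq_analyticRank_of_analyticRank_le_one) (h3 : realPeriodRat_eq_unit_mul_plusPeriod_three)
    (W : WeierstrassCurve ℚ) [W.IsElliptic] [W.IsGloballyMinimal]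
    (hI : integralModelInt W = ⟨0, 1, 0, (-2396088), (-1642476716)⟩) (hL : W.entireLFunction 1 ≠ 0)
    (hcertA : ∀ {N : ℕ} [NeZero N] (f : CuspForm (Gamma0 N) 2), IsNewformOf W f →
      ∃ n : ℕ, ‖PowerSeries.coeff n (padicLFunction f (unitRoot W 3 : ℚ_[3]))‖ = 1)
    (hcard : Nat.card (W.selmerGroup (3 : ℤ)) = 9)
    {q : ℚ} (hq : shaAn W = (q : ℂ)) (hv : padicValRat 3 q = 2) : BSDp W 3 :=
  haveI : Fact (Nat.Prime 13) := ⟨by norm_num⟩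
  bsdp_three_shaCell_of_ainvs_of_fine_of_card_selmerThree hfine hS hmodP hGZK h3 0 1 0 (-2396088) (-1642476716) hI
    13 11 6 (by decide +kernel) (by decide +kernel) (by decide) (by decide) (by decide) (by decide +kernel)
    (by decide +kernel) (by decide +kernel) hL hcertA hcard hq hv.le

/-! ### `110224f1` (3Ns, `N = 110224 = 2^4·83^2`, analytic rank `0`, `#Ш_an = 9` — Ш-CELL) -/

/-- **`BSD(E,3)` AT THE PAIR `(110224f1, 3)` MODULO F1 + PUBLISHED FACTS + CERTIFICATES — Ш-cell on the F1 road**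
(`MuZeroRoad.bsdp_three_shaCell_of_ainvs_of_fine_of_card_selmerThree`: F1 upper half + ONE exact `3`-descent lower
half; NO CTP pairing certificate). Cremona model `[0, 1, 0, -6670848, -12548797516]`, `N = 110224 = 2^4·83^2`, census image `3Ns`; IN THE KERNEL:
`3 ∤ Δ`, `#Ẽ(𝔽₃) = 3` (`a₃ = 1`: good ORDINARY, ANOMALOUS), Frobenius witness `ℓ = 13`: `ℓ ∤ Δ`, `#Ẽ(𝔽_{13}) = 8`
(`a_{13} = 6`), `X² − a_{13}X + 13` root-free mod `3` (`E[3]` irreducible). Cremona `allbsd`: analytic rank `0`,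
`#E(ℚ)_tors = 1`, `∏ c_ℓ = 8`, `#Ш_an = 9`. DISPLAYED: F1 (`hfine`); PUBLISHED `hS`, `hmodP`, `hGZK`, `h3`; census /
certificates `hL`, `hcertA` (MUCERT3), `hcard` (`#Sel^(3)(E/ℚ) = 9`, the two-engine exact `3`-descent of record — the
same binder as the CTP record `bsdp_t110224f1`), `hq`/`hv` (`ord₃ #Ш_an = 2`). Second road; per pair; nothing booked.
[cite: Kato2004Asterisque, Thm. 12.6 (p. 222), Thm. 17.4 (2), (3) (p. 273) and §17.13 (pp. 279–280)]
[cite: SilvermanAEC2009, Thm. X.4.2 (a)] [cite: Mazur1978, §6 Prop. 6.3 (1) (p. 153)]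
[cite: Miller2011LMS, Def. 1.1 (arXiv:1010.2431 p. 3)] [cite: Cremona2006, Table 1 (Cremona label 110224f1)] -/
theorem bsdp_three_sha_e110224f1_of_fine
    (hfine : exists_divisibilityInputs_fineQuotient_zeta)
    (hS : Schneider1985_order_charGenerator_odd) (hmodP : nonempty_modularParametrizationData)
    (hGZK : rank_eq_analyticRank_of_analyticRank_le_one) (h3 : realPeriodRat_eq_unit_mul_plusPeriod_three)
    (W : WeierstrassCurve ℚ) [W.IsElliptic] [W.IsGloballyMinimal]
    (hI : integralModelInt W = ⟨0, 1, 0, (-6670848), (-12548797516)⟩) (hL : W.entireLFunction 1 ≠ 0)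
    (hcertA : ∀ {N : ℕ} [NeZero N] (f : CuspForm (Gamma0 N) 2), IsNewformOf W f →
      ∃ n : ℕ, ‖PowerSeries.coeff n (padicLFunction f (unitRoot W 3 : ℚ_[3]))‖ = 1)
    (hcard : Nat.card (W.selmerGroup (3 : ℤ)) = 9)
    {q : ℚ} (hq : shaAn W = (q : ℂ)) (hv : padicValRat 3 q = 2) : BSDp W 3 :=
  haveI : Fact (Nat.Prime 13) := ⟨by norm_num⟩
  bsdp_three_shaCell_of_ainvs_of_fine_of_card_selmerThree hfine hS hmodP hGZK h3 0 1 0 (-6670848) (-12548797516) hI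
    13 8 3 (by decide +kernel) (by decide +kernel) (by decide) (by decide) (by decide) (by decide +kernel)
    (by decide +kernel) (by decide +kernel) hL hcertA hcard hq hv.le

/-! ### `129605x1` (3Ns, `N = 129605 = 5·7^2·23^2`, analytic rank `0`, `#Ш_an = 9` — Ш-CELL) -/

/-- **`BSD(E,3)` AT THE PAIR `(129605x1, 3)` MODULO F1 + PUBLISHED FACTS + CERTIFICATES — Ш-cell on the F1 road**
(`MuZeroRoad.bsdp_three_shaCell_of_ainvs_of_fine_of_card_selmerThree`: F1 upper half + ONE exact `3`-descent lower
half; NO CTP pairing certificate). Cremona model `[0, -1, 1, -397455, -265605047]`, `N = 129605 = 5·7^2·23^2`, census image `3Ns`; IN THE KERNEL: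
`3 ∤ Δ`, `#Ẽ(𝔽₃) = 2` (`a₃ = 2`: good ORDINARY), Frobenius witness `ℓ = 19`: `ℓ ∤ Δ`, `#Ẽ(𝔽_{19}) = 14`
(`a_{19} = 6`), `X² − a_{19}X + 19` root-free mod `3` (`E[3]` irreducible). Cremona `allbsd`: analytic rank `0`,
`#E(ℚ)_tors = 1`, `∏ c_ℓ = 6`, `#Ш_an = 9`. DISPLAYED: F1 (`hfine`); PUBLISHED `hS`, `hmodP`, `hGZK`, `h3`; census /
certificates `hL`, `hcertA` (MUCERT3), `hcard` (`#Sel^(3)(E/ℚ) = 9`, the two-engine exact `3`-descent of record — the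
same binder as the CTP record `bsdp_t129605x1`), `hq`/`hv` (`ord₃ #Ш_an = 2`). Second road; per pair; nothing booked.
[cite: Kato2004Asterisque, Thm. 12.6 (p. 222), Thm. 17.4 (2), (3) (p. 273) and §17.13 (pp. 279–280)]
[cite: SilvermanAEC2009, Thm. X.4.2 (a)] [cite: Mazur1978, §6 Prop. 6.3 (1) (p. 153)]
[cite: Miller2011LMS, Def. 1.1 (arXiv:1010.2431 p. 3)] [cite: Cremona2006, Table 1 (Cremona label 129605x1)] -/
theorem bsdp_three_sha_e129605x1_of_fine
    (hfine : exists_divisibilityInputs_fineQuotient_zeta)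
    (hS : Schneider1985_order_charGenerator_odd) (hmodP : nonempty_modularParametrizationData)
    (hGZK : rank_eq_analyticRank_of_analyticRank_le_one) (h3 : realPeriodRat_eq_unit_mul_plusPeriod_three)
    (W : WeierstrassCurve ℚ) [W.IsElliptic] [W.IsGloballyMinimal]
    (hI : integralModelInt W = ⟨0, (-1), 1, (-397455), (-265605047)⟩) (hL : W.entireLFunction 1 ≠ 0)
    (hcertA : ∀ {N : ℕ} [NeZero N] (f : CuspForm (Gamma0 N) 2), IsNewformOf W f →
      ∃ n : ℕ, ‖PowerSeries.coeff n (padicLFunction f (unitRoot W 3 : ℚ_[3]))‖ = 1)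
    (hcard : Nat.card (W.selmerGroup (3 : ℤ)) = 9)
    {q : ℚ} (hq : shaAn W = (q : ℂ)) (hv : padicValRat 3 q = 2) : BSDp W 3 :=
  haveI : Fact (Nat.Prime 19) := ⟨by norm_num⟩
  bsdp_three_shaCell_of_ainvs_of_fine_of_card_selmerThree hfine hS hmodP hGZK h3 0 (-1) 1 (-397455) (-265605047) hI
    19 14 2 (by decide +kernel) (by decide +kernel) (by decide) (by decide) (by decide) (by decide +kernel)
    (by decide +kernel) (by decide +kernel) hL hcertA hcard hq hv.le

/-! ### `183184b1` (3Ns, `N = 183184 = 2^4·107^2`, analytic rank `0`, `#Ш_an = 9` — Ш-CELL) -/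

/-- **`BSD(E,3)` AT THE PAIR `(183184b1, 3)` MODULO F1 + PUBLISHED FACTS + CERTIFICATES — Ш-cell on the F1 road**
(`MuZeroRoad.bsdp_three_shaCell_of_ainvs_of_fine_of_card_selmerThree`: F1 upper half + ONE exact `3`-descent lower
half; NO CTP pairing certificate). Cremona model `[0, 1, 0, -4491824, -94543873196]`, `N = 183184 = 2^4·107^2`, census image `3Ns`; IN THE KERNEL:
`3 ∤ Δ`, `#Ẽ(𝔽₃) = 6` (`a₃ = -2`: good ORDINARY, ANOMALOUS), Frobenius witness `ℓ = 7`: `ℓ ∤ Δ`, `#Ẽ(𝔽_{7}) = 8`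
(`a_{7} = 0`), `X² − a_{7}X + 7` root-free mod `3` (`E[3]` irreducible). Cremona `allbsd`: analytic rank `0`,
`#E(ℚ)_tors = 1`, `∏ c_ℓ = 8`, `#Ш_an = 9`. DISPLAYED: F1 (`hfine`); PUBLISHED `hS`, `hmodP`, `hGZK`, `h3`; census /
certificates `hL`, `hcertA` (MUCERT3), `hcard` (`#Sel^(3)(E/ℚ) = 9`, the two-engine exact `3`-descent of record — the
same binder as the CTP record `bsdp_t183184b1`), `hq`/`hv` (`ord₃ #Ш_an = 2`). Second road; per pair; nothing booked.
[cite: Kato2004Asterisque, Thm. 12.6 (p. 222), Thm. 17.4 (2), (3) (p. 273) and §17.13 (pp. 279–280)]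
[cite: SilvermanAEC2009, Thm. X.4.2 (a)] [cite: Mazur1978, §6 Prop. 6.3 (1) (p. 153)]
[cite: Miller2011LMS, Def. 1.1 (arXiv:1010.2431 p. 3)] [cite: Cremona2006, Table 1 (Cremona label 183184b1)] -/
theorem bsdp_three_sha_e183184b1_of_fine
    (hfine : exists_divisibilityInputs_fineQuotient_zeta)
    (hS : Schneider1985_order_charGenerator_odd) (hmodP : nonempty_modularParametrizationData)
    (hGZK : rank_eq_analyticRank_of_analyticRank_le_one) (h3 : realPeriodRat_eq_unit_mul_plusPeriod_three)
    (W : WeierstrassCurve ℚ) [W.IsElliptic] [W.IsGloballyMinimal]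
    (hI : integralModelInt W = ⟨0, 1, 0, (-4491824), (-94543873196)⟩) (hL : W.entireLFunction 1 ≠ 0)
    (hcertA : ∀ {N : ℕ} [NeZero N] (f : CuspForm (Gamma0 N) 2), IsNewformOf W f →
      ∃ n : ℕ, ‖PowerSeries.coeff n (padicLFunction f (unitRoot W 3 : ℚ_[3]))‖ = 1)
    (hcard : Nat.card (W.selmerGroup (3 : ℤ)) = 9)
    {q : ℚ} (hq : shaAn W = (q : ℂ)) (hv : padicValRat 3 q = 2) : BSDp W 3 :=
  haveI : Fact (Nat.Prime 7) := ⟨by norm_num⟩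
  bsdp_three_shaCell_of_ainvs_of_fine_of_card_selmerThree hfine hS hmodP hGZK h3 0 1 0 (-4491824) (-94543873196) hI
    7 8 6 (by decide +kernel) (by decide +kernel) (by decide) (by decide) (by decide) (by decide +kernel)
    (by decide +kernel) (by decide +kernel) hL hcertA hcard hq hv.le

end Summit.BirchSwinnertonDyer.Rank1Residual.X10.MuZeroRoad

end
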